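import Summits.PneNP.PneNP.Theorems.SliceACZero.Negative.WindowDepth
import Summits.PneNP.PneNP.Theorems.SliceACZero.Negative.SliceDensity
import Summits.PneNP.PneNP.Theorems.SliceACZero.Negative.DisjointCliques
import Literature.Computability.Complexity.CliqueRestriction

/-!
# Negative lemmas for crux `SliceACZero` (stmt-PneNP-2835), Part VIII-C: the window of `Conc` cannot
reach the supercritical slices `j ≈ m · n^{θ}`

Mirror image of `WindowDepth.lean` (Part V, lower edge `m · n^{-ε}`), built on `SliceDensity.lean`
(VIII-A: slice density of a down-set `≤ 2 ·` its biased measure at `q = j/2N`) and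
`DisjointCliques.lean` (VIII-B: `Pr_{G(n,q)}[no k-clique] ≤ (1 − q^{C(k,2)})^{⌊n/k⌋}`):

* `card_slice_cliqueFree_le` — on the slice `j`, the clique-free vectors are at most a
  `2 (1 − (j/2C(n,2))^{C(k,2)})^{⌊n/k⌋}` fraction;
* `highWindow_eventually` — the arithmetic: at `j = ⌊m n^{θ'}⌋₊`, `⌊n/k⌋ (j/2N)^{C(k,2)} → ∞`;
* `not_innerConcHighWindow` — the inner clause of `Conc` with the window `[m, m · n^{θ}]` is FALSE for
  `d ≥ 1`, every `c`, `k ≥ 3`, every `δ > 0`, whenever `θ > 2/k` (constant-`1` circuit);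
* `not_innerConcHighWindow_of_le` — and for `k ≤ c`, `d ≥ 2`, every `θ ≥ 0` (clique DNF at the centre);
* `not_concHighWindow` — hence the GLOBAL statement with that window is false for every `θ > 0`.

With Part V the admissible windows of `Conc` are `m · n^{±o(1)}` globally (per-`k` sharpness for
`0 < θ ≤ 2/k` would need Janson; not attempted). Sorry-free, standard axioms; no Theses decl asserted
positively. Refuter seat cdisprove-stmt-PneNP-2835 (gen 2), 2026-08-16.
-/

noncomputable section

namespace Summit.PneNP.PneNP.Theorems.SliceACZero.Negative

open Literature.Computability.Complexity Filter Finset Literature.Combinatorics.SetFamily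
open scoped FinsetFamily Topology

section HighWindow

variable {n : ℕ}

/-- The slice error of the constant-`1` circuit against `k`-CLIQUE counts the clique-FREE vectors of
the slice. [folklore] -/
theorem sliceErr_const_true (j k : ℕ) :
    sliceErr n j (Circuit.const _ true).eval (cliqueFn n k) =
      #(univ.filter fun x : (⊤ : SimpleGraph (Fin n)).edgeSet → Bool =>
        edgeCount x = j ∧ cliqueFn n k x = false) := by
  unfold sliceErr
  congr 1
  refine Finset.filter_congr fun x _ => ?_
  rw [Circuit.eval_const]
  constructor
  · rintro ⟨h1, h2⟩
    refine ⟨h1, ?_⟩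
    cases h : cliqueFn n k x
    · rfl
    · exact absurd h.symm h2
  · rintro ⟨h1, h2⟩
    refine ⟨h1, ?_⟩
    rw [h2]
    decide

open Classical in
/-- **Clique-free graphs are rare on supercritical slices, quantitatively**: for `1 ≤ j ≤ C(n,2)`,
`#{x : |x| = j, x k-clique-free} ≤ 2 (1 − (j/2C(n,2))^{C(k,2)})^{⌊n/k⌋} · #{x : |x| = j}`
(Part VIII-A for the down-set of supports of clique-free vectors, whose biased measure is
`Pr_{G(n,q)}[no k-clique]`, bounded by Part VIII-B). [folklore] -/
theorem card_slice_cliqueFree_le {j : ℕ} (hj : 1 ≤ j) (hjN : j ≤ n.choose 2) (k : ℕ) :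
    (#(univ.filter fun x : (⊤ : SimpleGraph (Fin n)).edgeSet → Bool =>
        edgeCount x = j ∧ cliqueFn n k x = false) : ℝ) ≤
      2 * (1 - ((j : ℝ) / (2 * (n.choose 2 : ℕ))) ^ k.choose 2) ^ (n / k) * sliceCard n j := by
  set E := (⊤ : SimpleGraph (Fin n)).edgeSet with hE
  set 𝒟 : Finset (Finset E) := (univ.filter fun x : E → Bool => cliqueFn n k x = false).image supp
    with h𝒟
  -- 𝒟 is a down-set
  have hlow : IsLowerSet (𝒟 : Set (Finset E)) := by
    intro W W' hW'W hW
    rw [Finset.mem_coe, h𝒟, Finset.mem_image] at hW ⊢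
    obtain ⟨x, hx, rfl⟩ := hW
    rw [Finset.mem_filter] at hx
    refine ⟨fun e => decide (e ∈ W'), ?_, supp_indicator W'⟩
    rw [Finset.mem_filter]
    refine ⟨Finset.mem_univ _, ?_⟩
    have hle : (fun e => decide (e ∈ W')) ≤ x := by
      intro e
      by_cases he : e ∈ W'
      · have : x e = true := mem_supp.1 (hW'W he)
        rw [this]
        exact le_top
      · simp [he]
    have hmono := cliqueFn_monotone_holds n k hle
    rw [hx.2] at hmono
    cases h : cliqueFn n k (fun e => decide (e ∈ W'))
    · rfl
    · rw [h] at hmono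
      exact absurd hmono (by decide)
  -- its slice `j` is the image of our set
  have hslice : #(𝒟 # j) = #(univ.filter fun x : E → Bool => edgeCount x = j ∧ cliqueFn n k x = false) := by
    have : 𝒟 # j = (univ.filter fun x : E → Bool => edgeCount x = j ∧ cliqueFn n k x = false).image supp := by
      ext W
      simp only [Finset.slice, h𝒟, Finset.mem_filter, Finset.mem_image, Finset.mem_univ, true_and]
      constructor
      · rintro ⟨⟨x, hx, rfl⟩, hcard⟩
        exact ⟨x, ⟨by rw [← card_supp]; exact hcard, hx⟩, rfl⟩
      · rintro ⟨x, ⟨hcard, hx⟩, rfl⟩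
        exact ⟨⟨x, hx, rfl⟩, by rw [card_supp]; exact hcard⟩
    rw [this, Finset.card_image_of_injective _ supp_injective]
  -- its biased measure is Pr[no k-clique]
  have hmeas : ∀ q : ℝ, ∑ W ∈ 𝒟, biasedWeight q W =
      ∑ x ∈ univ.filter (fun x : E → Bool => cliqueFn n k x = false), gnpWeight n q x := by
    intro q
    rw [h𝒟, Finset.sum_image fun x _ y _ h => supp_injective h]
    refine Finset.sum_congr rfl fun x _ => ?_
    rw [biasedWeight, card_supp, card_edgeSet_top_fin, gnpWeight]
  have hcardE : Fintype.card E = n.choose 2 := card_edgeSet_top_fin n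
  -- Part VIII-A
  have hA := card_slice_div_choose_le_two_mul_sum_biasedWeight 𝒟 hlow hj (by rw [hcardE]; exact hjN)
  rw [hcardE, hslice, hmeas] at hA
  -- Part VIII-B
  have hN0 : (0 : ℝ) < ((n.choose 2 : ℕ) : ℝ) := by exact_mod_cast (show 0 < n.choose 2 by omega)
  have hq0 : (0 : ℝ) ≤ (j : ℝ) / (2 * (n.choose 2 : ℕ)) := by positivity
  have hq1 : (j : ℝ) / (2 * (n.choose 2 : ℕ)) ≤ 1 := by
    rw [div_le_one (by positivity)]
    have : (j : ℝ) ≤ (n.choose 2 : ℕ) := by exact_mod_cast hjN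
    linarith
  have hB := gnpProb_cliqueFree_le_pow (n := n) k hq0 hq1
  have hpos : (0 : ℝ) < ((n.choose 2).choose j : ℕ) := by exact_mod_cast Nat.choose_pos hjN
  rw [div_le_iff₀ hpos] at hA
  rw [sliceCard_eq]
  calc (#(univ.filter fun x : E → Bool => edgeCount x = j ∧ cliqueFn n k x = false) : ℝ)
      ≤ 2 * (∑ x ∈ univ.filter (fun x : E → Bool => cliqueFn n k x = false),
          gnpWeight n ((j : ℝ) / (2 * (n.choose 2 : ℕ))) x) * ((n.choose 2).choose j : ℕ) := hA
    _ ≤ 2 * (1 - ((j : ℝ) / (2 * (n.choose 2 : ℕ))) ^ k.choose 2) ^ (n / k) * ((n.choose 2).choose j : ℕ) :=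
        mul_le_mul_of_nonneg_right (mul_le_mul_of_nonneg_left hB (by norm_num)) (Nat.cast_nonneg _)

/-- `(1 − x)^T ≤ exp(−T x)` for `x ≤ 1`. [folklore] -/
theorem one_sub_pow_le_exp {x : ℝ} (hx1 : x ≤ 1) (T : ℕ) :
    (1 - x) ^ T ≤ Real.exp (-((T : ℝ) * x)) := by
  calc (1 - x) ^ T ≤ (Real.exp (-x)) ^ T :=
        pow_le_pow_left₀ (by linarith) (Real.one_sub_le_exp_neg x) T
    _ = Real.exp (-((T : ℝ) * x)) := by rw [← Real.exp_nat_mul]; ring_nf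

/-- `C(n,2) ≥ n²/4` for `n ≥ 2`. [folklore] -/
theorem sq_div_four_le_choose_two (hn : 2 ≤ n) : (n : ℝ) ^ 2 / 4 ≤ ((n.choose 2 : ℕ) : ℝ) := by
  rw [Nat.cast_choose_two]
  have h2 : (2 : ℝ) ≤ n := by exact_mod_cast hn
  nlinarith

set_option maxHeartbeats 400000 in
/-- **Arithmetic of the supercritical slice.** For `k ≥ 3`, `2/k < θ' < 2/(k-1)` and `L`, eventually
in `n`: with `N = C(n,2)`, `m = m_k(n)`, `j = ⌊m n^{θ'}⌋₊`, `q = j/(2N)`: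
`1 ≤ j ≤ N` and `⌊n/k⌋ · q^{C(k,2)} ≥ L`. [folklore] -/
theorem highWindow_eventually {k : ℕ} (hk : 3 ≤ k) {θ' : ℝ} (hθlo : 2 / (k : ℝ) < θ')
    (hθhi : θ' < 2 / ((k : ℝ) - 1)) (L : ℝ) :
    ∀ᶠ n : ℕ in atTop, 1 ≤ ⌊(mk n k : ℝ) * (n : ℝ) ^ θ'⌋₊ ∧ ⌊(mk n k : ℝ) * (n : ℝ) ^ θ'⌋₊ ≤ n.choose 2 ∧
      L ≤ ((n / k : ℕ) : ℝ) *
        ((⌊(mk n k : ℝ) * (n : ℝ) ^ θ'⌋₊ : ℝ) / (2 * (n.choose 2 : ℕ))) ^ k.choose 2 := by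
  -- constants
  have hk3 : (3 : ℝ) ≤ k := by exact_mod_cast hk
  have hk0 : (0 : ℝ) < k := by linarith
  have hk1 : (0 : ℝ) < (k : ℝ) - 1 := by linarith
  set α : ℝ := 2 / ((k : ℝ) - 1) with hα
  have hα1 : α ≤ 1 := by rw [hα, div_le_one hk1]; linarith
  have hα0 : 0 < α := by positivity
  have hθ0 : 0 < θ' := lt_trans (by positivity) hθlo
  set K : ℕ := k.choose 2 with hK
  have hKr : (K : ℝ) = k * ((k : ℝ) - 1) / 2 := by rw [hK, Nat.cast_choose_two]
  -- the exponent of growth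
  set γ : ℝ := 1 + θ' * K - k with hγ
  have hγ0 : 0 < γ := by
    have hKpos : (0 : ℝ) < k * ((k : ℝ) - 1) / 2 := div_pos (mul_pos hk0 hk1) two_pos
    have : ((k : ℝ) - 1) < θ' * K := by
      rw [hKr]
      have h1 : (k : ℝ) - 1 = 2 / (k : ℝ) * (k * ((k : ℝ) - 1) / 2) := by field_simp
      calc (k : ℝ) - 1 = 2 / (k : ℝ) * (k * ((k : ℝ) - 1) / 2) := h1
        _ < θ' * (k * ((k : ℝ) - 1) / 2) := mul_lt_mul_of_pos_right hθlo hKpos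
    rw [hγ]; linarith
  have hαK : α * K = k := by rw [hα, hKr]; field_simp
  -- eventualities
  have h16 : ∀ᶠ n : ℕ in atTop, 16 ≤ n := eventually_ge_atTop 16
  have h2k : ∀ᶠ n : ℕ in atTop, 2 * k ≤ n := eventually_ge_atTop (2 * k)
  have hgrow : ∀ᶠ n : ℕ in atTop, 2 * k * 4 ^ K * max L 0 ≤ (n : ℝ) ^ γ :=
    ((tendsto_rpow_atTop hγ0).comp tendsto_natCast_atTop_atTop).eventually_ge_atTop _
  filter_upwards [h16, h2k, hgrow] with n hn16 hn2k hngrow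
  -- basic positivity
  have hn0 : (0 : ℝ) < n := by exact_mod_cast (show 0 < n by omega)
  have hn1 : (1 : ℝ) ≤ n := by exact_mod_cast (show 1 ≤ n by omega)
  have hN : (n : ℝ) ^ 2 / 4 ≤ ((n.choose 2 : ℕ) : ℝ) := sq_div_four_le_choose_two (by omega)
  have hNpos : (0 : ℝ) < ((n.choose 2 : ℕ) : ℝ) := by nlinarith
  set N : ℝ := ((n.choose 2 : ℕ) : ℝ) with hNdef
  set m : ℝ := (mk n k : ℝ) with hmdef
  have hm_up : m ≤ N * (n : ℝ) ^ (-α) := by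
    rw [hmdef, mk, hα, neg_div]
    exact Nat.floor_le (by positivity)
  have hm_lo : N * (n : ℝ) ^ (-α) - 1 ≤ m := by
    rw [hmdef, mk, hα, neg_div]
    have := Nat.lt_floor_add_one (((n.choose 2 : ℕ) : ℝ) * (n : ℝ) ^ (-(2 / ((k : ℝ) - 1))))
    linarith
  have hm0 : 0 ≤ m := Nat.cast_nonneg _
  set x : ℝ := m * (n : ℝ) ^ θ' with hxdef
  have hx0 : 0 ≤ x := by positivity
  set j : ℕ := ⌊x⌋₊ with hjdef
  have hj_up : (j : ℝ) ≤ x := Nat.floor_le hx0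
  have hj_lo : x - 1 ≤ j := by have := Nat.lt_floor_add_one x; linarith
  -- rpow bookkeeping
  have hpow_θα : (n : ℝ) ^ (-α) * (n : ℝ) ^ θ' = (n : ℝ) ^ (θ' - α) := by
    rw [← Real.rpow_add hn0]; ring_nf
  have hθα_neg : θ' - α < 0 := by rw [hα]; linarith
  have hθα_gt : -1 < θ' - α := by linarith
  have hnθα_le1 : (n : ℝ) ^ (θ' - α) ≤ 1 := Real.rpow_le_one_of_one_le_of_nonpos hn1 hθα_neg.le
  have hnθ1 : 1 ≤ (n : ℝ) ^ θ' := Real.one_le_rpow hn1 hθ0.le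
  -- (1) j ≤ N
  have hjN : (j : ℝ) ≤ N := by
    calc (j : ℝ) ≤ x := hj_up
      _ ≤ N * (n : ℝ) ^ (-α) * (n : ℝ) ^ θ' := mul_le_mul_of_nonneg_right hm_up (by positivity)
      _ = N * (n : ℝ) ^ (θ' - α) := by rw [mul_assoc, hpow_θα]
      _ ≤ N * 1 := mul_le_mul_of_nonneg_left hnθα_le1 hNpos.le
      _ = N := mul_one _
  -- (2) q ≥ n^{θ'-α}/4
  have hq_lo : (n : ℝ) ^ (θ' - α) / 4 ≤ (j : ℝ) / (2 * N) := by
    -- j ≥ N n^{θ'-α} − n^{θ'} − 1 and N ≥ n²/4, n ≥ 16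
    have h1 : N * (n : ℝ) ^ (θ' - α) - (n : ℝ) ^ θ' - 1 ≤ j := by
      calc N * (n : ℝ) ^ (θ' - α) - (n : ℝ) ^ θ' - 1
          = (N * (n : ℝ) ^ (-α) - 1) * (n : ℝ) ^ θ' - 1 := by rw [sub_mul, mul_assoc, hpow_θα, one_mul]
        _ ≤ m * (n : ℝ) ^ θ' - 1 := by
            have := mul_le_mul_of_nonneg_right hm_lo (by positivity : (0 : ℝ) ≤ (n : ℝ) ^ θ')
            linarith
        _ ≤ j := hj_lo
    -- n^{θ'} + 1 ≤ N n^{θ'-α} / 2, since N n^{θ'-α} ≥ (n²/4) n^{θ'-1} = n^{1+θ'}/4 ≥ 4 n^{θ'}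
    have h2 : (n : ℝ) ^ θ' + 1 ≤ N * (n : ℝ) ^ (θ' - α) / 2 := by
      have hstep : (n : ℝ) ^ (1 + θ') / 4 ≤ N * (n : ℝ) ^ (θ' - α) := by
        have hexp : (n : ℝ) ^ (1 + θ') ≤ (n : ℝ) ^ 2 * (n : ℝ) ^ (θ' - α) := by
          rw [show (n : ℝ) ^ 2 = (n : ℝ) ^ (2 : ℝ) by norm_cast, ← Real.rpow_add hn0]
          exact Real.rpow_le_rpow_of_exponent_le hn1 (by linarith)
        calc (n : ℝ) ^ (1 + θ') / 4 ≤ (n : ℝ) ^ 2 * (n : ℝ) ^ (θ' - α) / 4 := by linarith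
          _ = (n : ℝ) ^ 2 / 4 * (n : ℝ) ^ (θ' - α) := by ring
          _ ≤ N * (n : ℝ) ^ (θ' - α) := mul_le_mul_of_nonneg_right hN (by positivity)
      have h16r : (16 : ℝ) ≤ n := by exact_mod_cast hn16
      have hpow1 : (n : ℝ) ^ (1 + θ') = n * (n : ℝ) ^ θ' := by
        rw [Real.rpow_add hn0, Real.rpow_one]
      have : 8 * ((n : ℝ) ^ θ' + 1) ≤ (n : ℝ) ^ (1 + θ') := by
        rw [hpow1]
        nlinarith
      linarith
    have key : N * (n : ℝ) ^ (θ' - α) ≤ 2 * j := by linarith [h1, h2]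
    rw [div_le_div_iff₀ (by norm_num) (by positivity)]
    linarith [key]
  -- (3) j ≥ 1 (from q > 0)
  have hq_pos : 0 < (j : ℝ) / (2 * N) := lt_of_lt_of_le (by positivity) hq_lo
  have hj1 : 1 ≤ j := by
    have : (0 : ℝ) < j := by
      have := mul_pos hq_pos (by positivity : (0 : ℝ) < 2 * N)
      rwa [div_mul_cancel₀ _ (by positivity)] at this
    exact_mod_cast this
  have hjN' : j ≤ n.choose 2 := by
    rw [hNdef] at hjN
    exact_mod_cast hjN
  refine ⟨hj1, hjN', ?_⟩
  -- (4) the growth bound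
  have hT : (n : ℝ) / (2 * k) ≤ ((n / k : ℕ) : ℝ) := by
    have h1 : ((n / k : ℕ) : ℝ) * k ≥ n - k := by
      have := Nat.div_add_mod n k
      have hmod : (n % k : ℕ) < k := Nat.mod_lt n (by omega)
      have hcast : ((n / k : ℕ) : ℝ) * k + ((n % k : ℕ) : ℝ) = n := by
        rw [mul_comm]; exact_mod_cast this
      have hmodr : ((n % k : ℕ) : ℝ) < k := by exact_mod_cast hmod
      linarith
    have h2 : (n : ℝ) - k ≥ n / 2 := by
      have : (2 * k : ℝ) ≤ n := by exact_mod_cast hn2k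
      linarith
    rw [div_le_iff₀ (by positivity)]
    linarith
  have hqK : (n : ℝ) ^ (θ' * K - k) / 4 ^ K ≤ ((j : ℝ) / (2 * N)) ^ K := by
    have h := pow_le_pow_left₀ (by positivity) hq_lo K
    rw [div_pow, ← Real.rpow_natCast ((n : ℝ) ^ (θ' - α)) K, ← Real.rpow_mul hn0.le] at h
    have hexp : (θ' - α) * (K : ℝ) = θ' * K - k := by rw [sub_mul, hαK]
    rwa [hexp] at h
  have hmain : (n : ℝ) ^ γ / (2 * k * 4 ^ K) ≤ ((n / k : ℕ) : ℝ) * ((j : ℝ) / (2 * N)) ^ K := by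
    have hsplit : (n : ℝ) ^ γ = n * (n : ℝ) ^ (θ' * K - k) := by
      rw [hγ, show 1 + θ' * K - k = 1 + (θ' * K - k) by ring, Real.rpow_add hn0, Real.rpow_one]
    rw [hsplit, ← div_mul_div_comm]
    exact mul_le_mul hT hqK (by positivity) (Nat.cast_nonneg _)
  have hL : L ≤ (n : ℝ) ^ γ / (2 * k * 4 ^ K) := by
    rw [le_div_iff₀ (by positivity)]
    calc L * (2 * k * 4 ^ K) ≤ max L 0 * (2 * k * 4 ^ K) :=
          mul_le_mul_of_nonneg_right (le_max_left _ _) (by positivity)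
      _ = 2 * k * 4 ^ K * max L 0 := by ring
      _ ≤ (n : ℝ) ^ γ := hngrow
  exact hL.trans hmain

/-- **The window cannot reach the supercritical slices `j ≈ m · n^{θ}`, `θ > 2/k`** (`d ≥ 1`, every
`c`, `k ≥ 3`, every `δ > 0`): there the constant-`1` circuit (size `1`) is `δ`-accurate eventually,
and `n ^ c < 1` fails. [folklore] -/
theorem not_innerConcHighWindow {d : ℕ} (hd : 1 ≤ d) (c : ℕ) {k : ℕ} (hk : 3 ≤ k) {δ θ : ℝ}
    (hδ : 0 < δ) (hθ : 2 / (k : ℝ) < θ) :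
    ¬ (∀ᶠ n : ℕ in atTop, ∀ j : ℕ, (mk n k : ℝ) ≤ j → (j : ℝ) ≤ (mk n k : ℝ) * (n : ℝ) ^ θ →
        ∀ C : Circuit ((⊤ : SimpleGraph (Fin n)).edgeSet), C.IsOver acBasis → C.acDepth ≤ d →
          (sliceErr n j C.eval (cliqueFn n k) : ℝ) ≤ δ * sliceCard n j → n ^ c < C.size) := by
  intro h
  -- choose θ' with 2/k < θ' < 2/(k-1), θ' ≤ θ
  have hk3 : (3 : ℝ) ≤ k := by exact_mod_cast hk
  have hkk : 2 / (k : ℝ) < 2 / ((k : ℝ) - 1) :=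
    div_lt_div_of_pos_left two_pos (by linarith) (by linarith)
  set θ' : ℝ := min θ ((2 / (k : ℝ) + 2 / ((k : ℝ) - 1)) / 2) with hθ'
  have hθlo : 2 / (k : ℝ) < θ' := lt_min hθ (by linarith)
  have hθhi : θ' < 2 / ((k : ℝ) - 1) := lt_of_le_of_lt (min_le_right _ _) (by linarith)
  have hθle : θ' ≤ θ := min_le_left _ _
  have hθ0 : 0 ≤ θ' := le_trans (by positivity) hθlo.le
  -- the target level for ⌊n/k⌋ q^K
  set L : ℝ := -Real.log (δ / 2) with hL
  obtain ⟨n, hn, hn1, hj1, hjN, hgrow⟩ :=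
    (h.and ((eventually_ge_atTop 1).and (highWindow_eventually hk hθlo hθhi L))).exists
  set j : ℕ := ⌊(mk n k : ℝ) * (n : ℝ) ^ θ'⌋₊ with hjdef
  have hn1r : (1 : ℝ) ≤ n := by exact_mod_cast hn1
  have hx0 : 0 ≤ (mk n k : ℝ) * (n : ℝ) ^ θ' := by positivity
  -- j is in the window [m, m n^θ]
  have hwin_lo : (mk n k : ℝ) ≤ j := by
    have : mk n k ≤ j := by
      refine Nat.le_floor ?_
      calc ((mk n k : ℕ) : ℝ) = (mk n k : ℝ) * 1 := (mul_one _).symm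
        _ ≤ (mk n k : ℝ) * (n : ℝ) ^ θ' :=
            mul_le_mul_of_nonneg_left (Real.one_le_rpow hn1r hθ0) (Nat.cast_nonneg _)
    exact_mod_cast this
  have hwin_hi : (j : ℝ) ≤ (mk n k : ℝ) * (n : ℝ) ^ θ := by
    calc (j : ℝ) ≤ (mk n k : ℝ) * (n : ℝ) ^ θ' := Nat.floor_le hx0
      _ ≤ (mk n k : ℝ) * (n : ℝ) ^ θ :=
          mul_le_mul_of_nonneg_left (Real.rpow_le_rpow_of_exponent_le hn1r hθle) (Nat.cast_nonneg _)
  -- the constant-1 circuit is δ-accurate on slice j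
  have hN0 : (0 : ℝ) < ((n.choose 2 : ℕ) : ℝ) := by exact_mod_cast (show 0 < n.choose 2 by omega)
  set q : ℝ := (j : ℝ) / (2 * (n.choose 2 : ℕ)) with hq
  have hq0 : 0 ≤ q := by positivity
  have hq1 : q ≤ 1 := by
    rw [hq, div_le_one (by positivity)]
    have : (j : ℝ) ≤ (n.choose 2 : ℕ) := by exact_mod_cast hjN
    linarith
  have hqK0 : 0 ≤ q ^ k.choose 2 := by positivity
  have hqK1 : q ^ k.choose 2 ≤ 1 := pow_le_one₀ hq0 hq1
  have herr : (sliceErr n j (Circuit.const _ true).eval (cliqueFn n k) : ℝ) ≤ δ * sliceCard n j := by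
    rw [sliceErr_const_true]
    refine (card_slice_cliqueFree_le hj1 hjN k).trans (mul_le_mul_of_nonneg_right ?_ (Nat.cast_nonneg _))
    -- 2 (1 - q^K)^T ≤ 2 exp(-T q^K) ≤ 2 exp(-L) = δ
    have h1 := one_sub_pow_le_exp hqK1 (n / k)
    have h2 : Real.exp (-(((n / k : ℕ) : ℝ) * q ^ k.choose 2)) ≤ δ / 2 := by
      rw [← Real.le_log_iff_exp_le (by positivity)]
      have : L ≤ ((n / k : ℕ) : ℝ) * q ^ k.choose 2 := hgrow
      rw [hL] at this
      linarith
    linarith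
  have hlt := hn j hwin_lo hwin_hi (Circuit.const _ true)
    (Circuit.const_isOver_acBasis true) (by rw [Circuit.acDepth_const]; exact hd) herr
  rw [Circuit.size_const] at hlt
  exact absurd (Nat.one_le_pow c n hn1) (not_le.2 hlt)

/-- **`k ≤ c` is impossible for the widened window too** (`d ≥ 2`, every `θ ≥ 0`, every `δ ≥ 0`):
the exhaustive clique DNF is exact at the centre `j = m`, which the window `[m, m n^{θ}]` contains.
[folklore] -/
theorem not_innerConcHighWindow_of_le {d c k : ℕ} (hd : 2 ≤ d) (hk : 2 ≤ k) (hkc : k ≤ c) {δ θ : ℝ}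
    (hδ : 0 ≤ δ) (hθ : 0 ≤ θ) :
    ¬ (∀ᶠ n : ℕ in atTop, ∀ j : ℕ, (mk n k : ℝ) ≤ j → (j : ℝ) ≤ (mk n k : ℝ) * (n : ℝ) ^ θ →
        ∀ C : Circuit ((⊤ : SimpleGraph (Fin n)).edgeSet), C.IsOver acBasis → C.acDepth ≤ d →
          (sliceErr n j C.eval (cliqueFn n k) : ℝ) ≤ δ * sliceCard n j → n ^ c < C.size) := by
  intro h
  obtain ⟨n, hn, hn2⟩ := (h.and (eventually_ge_atTop 2)).exists
  obtain ⟨C, hB, hD, hS, hE⟩ := exists_cliqueDNF n k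
  have herr : (sliceErr n (mk n k) C.eval (cliqueFn n k) : ℝ) ≤ δ * sliceCard n (mk n k) := by
    rw [sliceErr_eq_zero_of_forall _ hE, Nat.cast_zero]
    exact mul_nonneg hδ (Nat.cast_nonneg _)
  have hn1r : (1 : ℝ) ≤ n := by exact_mod_cast (show 1 ≤ n by omega)
  have hhi : ((mk n k : ℕ) : ℝ) ≤ (mk n k : ℝ) * (n : ℝ) ^ θ := by
    calc ((mk n k : ℕ) : ℝ) = (mk n k : ℝ) * 1 := (mul_one _).symm
      _ ≤ (mk n k : ℝ) * (n : ℝ) ^ θ :=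
          mul_le_mul_of_nonneg_left (Real.one_le_rpow hn1r hθ) (Nat.cast_nonneg _)
  have hlt := hn (mk n k) le_rfl hhi C hB (hD.trans hd) herr
  exact absurd (hS.trans (choose_succ_le_pow hn2 hk hkc)) (not_le.2 hlt)

/-- **The global statement with the window widened up to `m · n^{θ}` is false for EVERY `θ > 0`**
(`d = 2`, `c = ⌈2/θ⌉₊ + 1`: a witness `k ≤ c` is killed by the clique DNF, a witness `k > c` has
`2/k < θ` and is killed by the constant-`1` circuit on the slice `m · n^{θ'}`). So, together with
`not_innerConcLowWindow`, the admissible windows of `Conc` are `m · n^{±o(1)}`. [folklore] -/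
theorem not_concHighWindow {θ : ℝ} (hθ : 0 < θ) :
    ¬ ∀ d c : ℕ, ∃ k : ℕ, 3 ≤ k ∧ ∃ δ : ℝ, 0 < δ ∧ (∀ᶠ n : ℕ in atTop, ∀ j : ℕ,
        (mk n k : ℝ) ≤ j → (j : ℝ) ≤ (mk n k : ℝ) * (n : ℝ) ^ θ →
        ∀ C : Circuit ((⊤ : SimpleGraph (Fin n)).edgeSet), C.IsOver acBasis → C.acDepth ≤ d →
          (sliceErr n j C.eval (cliqueFn n k) : ℝ) ≤ δ * sliceCard n j → n ^ c < C.size) := by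
  intro h
  obtain ⟨k, hk, δ, hδ, hI⟩ := h 2 (⌈2 / θ⌉₊ + 1)
  by_cases hkc : k ≤ ⌈2 / θ⌉₊ + 1
  · exact not_innerConcHighWindow_of_le le_rfl (by omega) hkc hδ.le hθ.le hI
  · have hkθ : 2 / (k : ℝ) < θ := by
      have hceil : 2 / θ ≤ (⌈2 / θ⌉₊ : ℝ) := Nat.le_ceil _
      have hlt : (⌈2 / θ⌉₊ : ℝ) + 1 < k := by exact_mod_cast (show ⌈2 / θ⌉₊ + 1 < k by omega)
      have hk0 : (0 : ℝ) < k := by linarith [show (0:ℝ) ≤ (⌈2 / θ⌉₊ : ℝ) from Nat.cast_nonneg _]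
      rw [div_lt_iff₀ hk0]
      have : 2 / θ < k := by linarith
      rw [div_lt_iff₀ hθ] at this
      linarith [mul_comm θ (k:ℝ)]
    exact not_innerConcHighWindow (d := 2) (by norm_num) _ hk hδ hkθ hI

end HighWindow

end Summit.PneNP.PneNP.Theorems.SliceACZero.Negative

end
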